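import Literature.Probability.LatticeModels.BattleFederbushExpansion
import Mathlib.Analysis.InnerProductSpace.PiL2
import Mathlib.Algebra.BigOperators.Intervals
import HarnessLib

/-!
# The interpolation factors of the Battle–Brydges–Federbush formula are a Gram matrix of unit
vectors (Mastropietro 2008, (2.115)–(2.117))

Topic `Literature/Probability/LatticeModels`; continuation of `BattleFederbushExpansion.lean`.
For a valid script `s` with points `y₀, …, y_k` the decoupled interpolation point assigns to the
pair `{y_i, y_j}` (`i ≤ j`) the monomial `∏_{i ≤ m < j} t_{y_m}` (`decPt_mk_y`; Mastropietro's
`t_i t_{i+1} ⋯ t_{j-1}`, (2.116)).  For real parameters `t ∈ [0,1]^ι` these numbers form the Gram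
matrix of the **unit vectors** `u₀ = e₀`, `u_{j+1} = t_{y_j} u_j + √(1 - t_{y_j}²) e_{j+1}` of
`ℝ^{k+1}` ((2.115)): `⟪u_i, u_j⟫ = ∏_{i ≤ m < j} t_{y_m}` ((2.117); `inner_gramVec`), which is the
positivity structure ("`t_{ii'} = u_i · u_{i'}` for unit vectors", Benfatto–Giuliani–Mastropietro
2006, after (2.66)) that lets the Gram–Hadamard inequality bound the interpolated determinants
`det G^T(t)` of the fermionic tree expansion without factorials.

## Main results (namespace `Literature.Probability.LatticeModels.BattleFederbush`)

* `gramVec τ N n` (the vectors (2.115) in `EuclideanSpace ℝ (Fin N)`), `norm_gramVec`,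
  `inner_gramVec` (`= ∏_{l ∈ [i, j)} τ_l`);
* `Script.decPt_mk_y`, `Script.eval_decPt_mk_y` — the interpolation factor of a pair of points;
* `Script.exists_unit_gram` — for `t ∈ [0,1]^ι` there are unit vectors `u_i` with
  `σ_s({y_i, y_j})(t) = ⟪u_i, u_j⟫` for all `i, j`.

## Sources

V. Mastropietro, *Non-Perturbative Renormalization* (2008), §2.9, (2.115)–(2.117), PDF p. 48 of
the held copy (`Mastropietro2008`); G. Benfatto, A. Giuliani, V. Mastropietro, Ann. Henri Poincaré
7 (2006), after (2.66) (`BenfattoGiulianiMastropietro2006`).  Everything is proved; no named fact.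
-/

noncomputable section

open MvPolynomial Finsupp Literature.RingTheory.MvPolynomial
open scoped InnerProductSpace

namespace Literature.Probability.LatticeModels

namespace BattleFederbush

/-! ### The Gram vectors -/

section Gram

variable (N : ℕ)

/-- The `n`-th standard basis vector of `ℝ^N` (zero if `n ≥ N`). [folklore] -/
def stdVec (n : ℕ) : EuclideanSpace ℝ (Fin N) :=
  if h : n < N then EuclideanSpace.single ⟨n, h⟩ 1 else 0

/-- The **Gram vectors** of Mastropietro 2008, (2.115): `u₀ = e₀`,
`u_{n+1} = τ_n u_n + √(1 - τ_n²) e_{n+1}`. [cite: Mastropietro2008, §2.9 (2.115)] -/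
def gramVec (τ : ℕ → ℝ) : ℕ → EuclideanSpace ℝ (Fin N)
  | 0 => stdVec N 0
  | n + 1 => τ n • gramVec τ n + Real.sqrt (1 - τ n ^ 2) • stdVec N (n + 1)

variable {N}

/-- Standard basis vectors are orthonormal (as far as they exist). [folklore] -/
theorem inner_stdVec_stdVec (a b : ℕ) :
    ⟪stdVec N a, stdVec N b⟫_ℝ = if a = b ∧ a < N then 1 else 0 := by
  unfold stdVec
  split_ifs with ha hb hb h h <;> simp_all [EuclideanSpace.inner_single_left, Fin.ext_iff]
  · omega
  · omega

/-- `‖e_n‖ = 1` for `n < N`. [folklore] -/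
theorem norm_stdVec {n : ℕ} (hn : n < N) : ‖stdVec N n‖ = 1 := by
  rw [← sq_eq_sq₀ (norm_nonneg _) zero_le_one, ← real_inner_self_eq_norm_sq, inner_stdVec_stdVec,
    if_pos ⟨rfl, hn⟩, one_pow]

/-- The Gram vector `u_n` lies in the span of `e₀, …, e_n`. [folklore] -/
theorem inner_gramVec_stdVec_eq_zero (τ : ℕ → ℝ) : ∀ {n m : ℕ}, n < m → ⟪gramVec N τ n, stdVec N m⟫_ℝ = 0
  | 0, m, h => by
    rw [gramVec, inner_stdVec_stdVec, if_neg]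
    omega
  | n + 1, m, h => by
    rw [gramVec, inner_add_left, real_inner_smul_left, real_inner_smul_left,
      inner_gramVec_stdVec_eq_zero τ (Nat.lt_of_succ_lt h), inner_stdVec_stdVec, if_neg, mul_zero,
      mul_zero, add_zero]
    omega

/-- **The Gram vectors are unit vectors** (for `|τ_n| ≤ 1`). [cite: Mastropietro2008, §2.9 (2.115)] -/
theorem norm_gramVec (τ : ℕ → ℝ) (hτ : ∀ n, τ n ^ 2 ≤ 1) : ∀ {n : ℕ}, n < N → ‖gramVec N τ n‖ = 1
  | 0, h => by rw [gramVec]; exact norm_stdVec h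
  | n + 1, h => by
    have ih := norm_gramVec τ hτ (Nat.lt_of_succ_lt h)
    have h0 : ⟪gramVec N τ n, stdVec N (n + 1)⟫_ℝ = 0 := inner_gramVec_stdVec_eq_zero τ (Nat.lt_succ_self n)
    rw [← sq_eq_sq₀ (norm_nonneg _) zero_le_one, gramVec, norm_add_sq_real, norm_smul, norm_smul, ih,
      norm_stdVec h, real_inner_smul_left, real_inner_smul_right, h0, Real.norm_eq_abs, Real.norm_eq_abs,
      mul_one, mul_one, sq_abs, sq_abs, Real.sq_sqrt (sub_nonneg.2 (hτ n))]
    ring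

/-- **The interpolation factors as inner products** (Mastropietro 2008, (2.117)):
`⟪u_i, u_j⟫ = τ_i τ_{i+1} ⋯ τ_{j-1}` for `i ≤ j < N`. [cite: Mastropietro2008, §2.9 (2.117)] -/
theorem inner_gramVec (τ : ℕ → ℝ) (hτ : ∀ n, τ n ^ 2 ≤ 1) {i j : ℕ} (hij : i ≤ j) (hj : j < N) :
    ⟪gramVec N τ i, gramVec N τ j⟫_ℝ = ∏ l ∈ Finset.Ico i j, τ l := by
  induction j, hij using Nat.le_induction with
  | base =>
    rw [Finset.Ico_self, Finset.prod_empty, real_inner_self_eq_norm_sq, norm_gramVec τ hτ hj, one_pow]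
  | succ j hij ih =>
    rw [gramVec, inner_add_right, real_inner_smul_right, real_inner_smul_right, ih (Nat.lt_of_succ_lt hj),
      inner_gramVec_stdVec_eq_zero τ (Nat.lt_succ_of_le hij), mul_zero, add_zero,
      Finset.prod_Ico_succ_top hij, mul_comm]

end Gram

/-! ### The interpolation factor of a pair of points of a script -/

namespace Script

variable {ι : Type*} [DecidableEq ι] {root : ι} {k : ℕ} {R : Type*} [CommRing R]

/-- A pair of points `{y_i, y_j}` crosses the cut `m` iff exactly one of `i, j` is `≤ m`. [folklore] -/
theorem crossB_pre_mk_y (s : Script root k) (hs : s.Valid) (i j : Fin (k + 1)) (m : ℕ) :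
    crossB (s.pre m) s(s.y i, s.y j) = xor (decide ((i : ℕ) ≤ m)) (decide ((j : ℕ) ≤ m)) := by
  rw [crossB_mk, Bool.decide_congr (y_mem_pre_iff s hs i m), Bool.decide_congr (y_mem_pre_iff s hs j m)]

/-- **The interpolation factor of a pair of points** (`i ≤ j`): at the decoupled point,
`s_{{y_i, y_j}} ↦ ∏_{i ≤ m < j} t_{y_m}` (Mastropietro 2008, (2.96)/(2.116): `t_{n'(ℓ)} ⋯ t_{n(ℓ)-1}`).
[cite: Mastropietro2008, §2.8 (2.96)] -/
theorem decPt_mk_y (s : Script root k) (hs : s.Valid) {i j : Fin (k + 1)} (hij : i ≤ j) :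
    decPt R s s(s.y i, s.y j) =
      ∏ m ∈ Finset.univ.filter (fun m : Fin (k + 1) => i ≤ m ∧ m < j), X (s.y m) := by
  have hnc : crossB (s.pre k) s(s.y i, s.y j) = false := by
    rw [crossB_pre_mk_y s hs]
    have hi : (i : ℕ) ≤ k := Nat.lt_succ_iff.1 i.isLt
    have hj : (j : ℕ) ≤ k := Nat.lt_succ_iff.1 j.isLt
    simp [hi, hj]
  rw [decPt, hnc, livePt]
  simp only [Bool.false_eq_true, if_false]
  have hexp : s.cutExp k s(s.y i, s.y j) =
      ∑ m ∈ Finset.univ.filter (fun m : Fin (k + 1) => i ≤ m ∧ m < j), Finsupp.single (s.y m) 1 := by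
    rw [cutExp, Finset.sum_filter]
    refine Finset.sum_congr rfl fun m _ => ?_
    rw [crossB_pre_mk_y s hs]
    have hjk : (j : ℕ) ≤ k := Nat.lt_succ_iff.1 j.isLt
    have hij' : (i : ℕ) ≤ j := hij
    by_cases h1 : i ≤ m <;> by_cases h2 : m < j
    · have h1' : (i : ℕ) ≤ m := h1
      have h2' : (m : ℕ) < j := h2
      rw [if_pos, if_pos ⟨h1, h2⟩]
      refine ⟨by omega, ?_⟩
      simp [h1', show ¬ ((j : ℕ) ≤ m) by omega]
    · have h1' : (i : ℕ) ≤ m := h1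
      have h2' : ¬ (m : ℕ) < j := h2
      rw [if_neg, if_neg (fun h => h2 h.2)]
      simp [h1', show (j : ℕ) ≤ m by omega]
    · have h1' : ¬ (i : ℕ) ≤ m := h1
      rw [if_neg, if_neg (fun h => h1 h.1)]
      simp [h1', show ¬ (j : ℕ) ≤ m by omega]
    · rw [if_neg, if_neg (fun h => h1 h.1)]
      have h1' : ¬ (i : ℕ) ≤ m := h1
      simp [h1', show ¬ (j : ℕ) ≤ m by omega]
  rw [hexp]
  generalize Finset.univ.filter (fun m : Fin (k + 1) => i ≤ m ∧ m < j) = S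
  induction S using Finset.induction_on with
  | empty => simp
  | insert a S ha ih => rw [Finset.sum_insert ha, Finset.prod_insert ha, monomial_single_add, pow_one, ih]

/-- The value of the interpolation factor of `{y_i, y_j}` (`i ≤ j`) at real parameters:
`∏_{i ≤ m < j} t(y_m)`. [folklore] -/
theorem eval_decPt_mk_y (s : Script root k) (hs : s.Valid) {i j : Fin (k + 1)} (hij : i ≤ j) (t : ι → R) :
    eval t (decPt R s s(s.y i, s.y j)) =
      ∏ m ∈ Finset.univ.filter (fun m : Fin (k + 1) => i ≤ m ∧ m < j), t (s.y m) := by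
  rw [decPt_mk_y s hs hij, map_prod]
  simp

/-- The `Fin`-indexed product `∏_{i ≤ m < j} τ(m)` is the product over the integer interval
`[i, j)`. [folklore] -/
theorem prod_filter_eq_prod_Ico (τ : ℕ → R) (i j : Fin (k + 1)) :
    ∏ m ∈ Finset.univ.filter (fun m : Fin (k + 1) => i ≤ m ∧ m < j), τ m =
      ∏ l ∈ Finset.Ico (i : ℕ) j, τ l := by
  have hset : Finset.Ico (i : ℕ) j =
      (Finset.univ.filter (fun m : Fin (k + 1) => i ≤ m ∧ m < j)).map Fin.valEmbedding := by
    ext l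
    simp only [Finset.mem_map, Finset.mem_filter, Finset.mem_univ, true_and, Fin.valEmbedding_apply,
      Finset.mem_Ico]
    constructor
    · rintro ⟨h1, h2⟩
      exact ⟨⟨l, lt_of_lt_of_le h2 (le_of_lt j.isLt)⟩, ⟨h1, h2⟩, rfl⟩
    · rintro ⟨m, ⟨h1, h2⟩, rfl⟩
      exact ⟨h1, h2⟩
  rw [hset, Finset.prod_map]
  rfl

/-- **The interpolation factors form a Gram matrix of unit vectors** (Mastropietro 2008,
(2.115)–(2.117); Benfatto–Giuliani–Mastropietro 2006, after (2.66): "`t_{i,i'} = u_i · u_{i'}` for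
some family of vectors `u_i ∈ ℝ^s` of unit norm"): for a valid script `s` with points `y₀, …, y_k`
and real parameters `t ∈ [0,1]^ι` there are unit vectors `u₀, …, u_k ∈ ℝ^{k+1}` such that the
decoupled interpolation factor of every pair of points is their inner product,
`σ_s({y_i, y_j})(t) = ⟪u_i, u_j⟫` (diagonal included: `σ_s({y, y}) = 1 = ‖u‖²`). [cite: Mastropietro2008, §2.9 (2.115)-(2.117)] -/
theorem exists_unit_gram (s : Script root k) (hs : s.Valid) (t : ι → ℝ)
    (ht : ∀ x, t x ∈ Set.Icc (0 : ℝ) 1) :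
    ∃ u : Fin (k + 1) → EuclideanSpace ℝ (Fin (k + 1)),
      (∀ i, ‖u i‖ = 1) ∧ ∀ i j, eval t (decPt ℝ s s(s.y i, s.y j)) = ⟪u i, u j⟫_ℝ := by
  set τ : ℕ → ℝ := fun n => if h : n < k + 1 then t (s.y ⟨n, h⟩) else 0 with hτ
  have hτ1 : ∀ n, τ n ^ 2 ≤ 1 := by
    intro n
    simp only [hτ]
    split_ifs with h
    · obtain ⟨h0, h1⟩ := ht (s.y ⟨n, h⟩)
      nlinarith
    · norm_num
  refine ⟨fun i => gramVec (k + 1) τ i, fun i => norm_gramVec τ hτ1 i.isLt, fun i j => ?_⟩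
  have key : ∀ i j : Fin (k + 1), i ≤ j → eval t (decPt ℝ s s(s.y i, s.y j)) =
      ⟪gramVec (k + 1) τ i, gramVec (k + 1) τ j⟫_ℝ := by
    intro i j hij
    rw [eval_decPt_mk_y s hs hij, inner_gramVec τ hτ1 hij j.isLt,
      ← prod_filter_eq_prod_Ico (fun n => τ n) i j]
    refine Finset.prod_congr rfl fun m _ => ?_
    simp only [hτ, dif_pos m.isLt]
  rcases le_total i j with hij | hji
  · exact key i j hij
  · rw [Sym2.eq_swap, real_inner_comm, key j i hji]

end Script

end BattleFederbush

end Literature.Probability.LatticeModels
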